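import Mathlib
import HarnessLib
import Literature.Analysis.FluidPDE.DuchonRobertShellLaw

/-!
# Item `LrcModEntire` (stmt-NavierStokesRegularity-20428), registry twist_split v7 — rung (Q2) of the «ridge quasiconvexity» lever (memo `Cruxes/LrcModEntire/T2B-g14.md` §9):
# THE SECOND-ORDER EXPANSION OF THE CROSS-SECTION MAXIMUM NEAR A RIDGE, and QUASICONVEXITY OF ITS COEFFICIENT

LEAD of item 20428 ns-poloidal-K2-p3 g14 (`--supports stmt-NavierStokesRegularity-20428 --as helper`; sequel of `…PeaklessPlanarMaxPrinciple` (Q0) and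
`…RidgeQuasiconvex` (Q1)).  CLASS-FREE real analysis; the class enters only through the hypotheses a cell-prover supplies (Taylor expansion of `v₂(t,·,z)` across a
hot arc with a uniform third-order remainder — bounded jets (F1); quasiconvexity of the cross-section maximum — (Q1) from Peakless).

* `abs_sSup_sub_le_of_ridgeExpansion` — **the perturbed-ridge maximum.**  If `|g(n,z) − (N − ½κn² + αnz + ½βz²)| ≤ C(|n|+|z|)³` on `|n| ≤ r`, `|z| ≤ δ` with `κ > 0` and
  a thin tube `64·C·r ≤ κ`, then for `|z| ≤ δ` with `|α||z| ≤ κr`: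
  `|max_{|n|≤r} g(·,z) − N − ½(α²/κ + β)z²| ≤ (16C|α|³/κ³ + 4C)|z|³`
  (lower bound at `n₀ = αz/κ`; upper bound by completing the square, the cubic remainder near the ridge being absorbed by `½κ(n−n₀)²` in a thin tube).
* `quasiconvexOn_of_tendsto_eventually` — pointwise limits of EVENTUALLY quasiconvex families are quasiconvex (filter form of `…RidgeQuasiconvex.quasiconvexOn_of_tendsto`);
  `quasiconvexOn_affine_pos` — `c·f + d` (`c > 0`) is quasiconvex with `f`.
* `quasiconvexOn_coeff_of_expansion` — **(Q2)**: if `|R(s,z) − N − ½m(s)z²| ≤ C′|z|³` for `s ∈ S`, `0 < |z| ≤ δ′`, and every `s ↦ R(s,z)` (`0 < |z| ≤ δ′`) is quasiconvex on the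
  convex set `S`, then `m` is quasiconvex on `S` (`m(s) = lim 2(R(s,z) − N)/z²`).
* `quasiconvexOn_sq_of_ridgeLaw` — the (TH)-column reading: with the ridge law (`κ`, `β = θ_zz|_H` constant along the web) `m = α²/κ + β`, so **`s ↦ α(s)²` (= `|∇ₕ∂_z v₂|²`
  along the hot branch) is quasiconvex**.

WHAT THIS IS NOT: not a claim about Navier–Stokes regularity — elementary analysis for the research stubs `stub_T2b` / `stub_C2a'` / `stub_C2b'` (bears_on LADDER-NS N0,
item 20428 / crux 19708; both OPEN, ⟨27893⟩ OPEN).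
-/

noncomputable section

-- the summit and its single sub-problem share the name (CONVENTIONS §1), as in every Theorems file
set_option linter.dupNamespace false

namespace Summit.NavierStokesRegularity.NavierStokesRegularity.Theorems.PoloidalWindowDoorLrcModEntireRidgeSecondOrder

open Set Filter Topology

/-! ### Elementary inequalities -/

/-- `|x|³ = |x|·x²`. -/
theorem abs_pow_three (x : ℝ) : |x| ^ 3 = |x| * x ^ 2 := by
  rw [pow_succ, sq_abs]; ring

/-! ### The perturbed-ridge maximum -/

/-- **THE PERTURBED-RIDGE MAXIMUM.**  Let `g(n,z)` satisfy `|g(n,z) − (N − ½κn² + αnz + ½βz²)| ≤ C(|n|+|z|)³` for `|n| ≤ r`, `|z| ≤ δ`, with `κ > 0`, `C ≥ 0`,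
`r > 0`, `64·C·r ≤ κ`, and let `g(·,z)` be continuous on `[−r,r]`.  Then for `|z| ≤ δ` with `|α|·|z| ≤ κ·r`:
`|sSup (g(·,z) '' [−r,r]) − (N + ½(α²/κ + β)z²)| ≤ (16C|α|³/κ³ + 4C)·|z|³`. -/
theorem abs_sSup_sub_le_of_ridgeExpansion {g : ℝ → ℝ → ℝ} {N κ α β C r δ : ℝ}
    (hκ : 0 < κ) (hC : 0 ≤ C) (hr : 0 < r) (hrC : 64 * C * r ≤ κ)
    (hH : ∀ n z : ℝ, |n| ≤ r → |z| ≤ δ → |g n z - (N - κ / 2 * n ^ 2 + α * n * z + β / 2 * z ^ 2)| ≤ C * (|n| + |z|) ^ 3)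
    (hcont : ∀ z : ℝ, |z| ≤ δ → ContinuousOn (fun n => g n z) (Icc (-r) r))
    {z : ℝ} (hz : |z| ≤ δ) (hαz : |α| * |z| ≤ κ * r) :
    |sSup ((fun n => g n z) '' Icc (-r) r) - (N + (α ^ 2 / κ + β) / 2 * z ^ 2)| ≤
      (16 * C * |α| ^ 3 / κ ^ 3 + 4 * C) * |z| ^ 3 := by
  -- the cross-section image is compact and non-empty: the `sSup` is attained and bounds every value
  have hIc : IsCompact ((fun n => g n z) '' Icc (-r) r) := isCompact_Icc.image_of_continuousOn (hcont z hz)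
  have hne : ((fun n => g n z) '' Icc (-r) r).Nonempty := ⟨g 0 z, 0, ⟨by linarith, hr.le⟩, rfl⟩
  obtain ⟨nstar, hnstar, hmax⟩ := hIc.sSup_mem hne
  have hle : ∀ n ∈ Icc (-r) r, g n z ≤ sSup ((fun n => g n z) '' Icc (-r) r) := fun n hn =>
    le_csSup hIc.bddAbove ⟨n, hn, rfl⟩
  set M := sSup ((fun n => g n z) '' Icc (-r) r) with hMdef
  -- the ridge displacement `n₀ = αz/κ`
  set n₀ : ℝ := α * z / κ with hn₀
  have hn₀abs : |n₀| = |α| * |z| / κ := by rw [hn₀, abs_div, abs_mul, abs_of_pos hκ]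
  have hn₀r : |n₀| ≤ r := by rw [hn₀abs, div_le_iff₀ hκ]; linarith
  have hn₀mem : n₀ ∈ Icc (-r) r := ⟨by linarith [abs_le.1 hn₀r |>.1], (abs_le.1 hn₀r).2⟩
  -- completing the square
  have hsq : ∀ n : ℝ, N - κ / 2 * n ^ 2 + α * n * z + β / 2 * z ^ 2 =
      N + (α ^ 2 / κ + β) / 2 * z ^ 2 - κ / 2 * (n - n₀) ^ 2 := by
    intro n; rw [hn₀]; field_simp; ring
  have hz0 : 0 ≤ |z| := abs_nonneg z
  have hα0 : 0 ≤ |α| := abs_nonneg α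
  -- ### lower bound at `n₀`
  have hlow : N + (α ^ 2 / κ + β) / 2 * z ^ 2 - (16 * C * |α| ^ 3 / κ ^ 3 + 4 * C) * |z| ^ 3 ≤ M := by
    have h1 := (abs_le.1 (hH n₀ z hn₀r hz)).1
    have h2 := hle n₀ hn₀mem
    have e0 : κ / 2 * (n₀ - n₀) ^ 2 = 0 := by ring
    rw [hsq n₀, e0, sub_zero] at h1
    -- remainder: `C(|n₀|+|z|)³ = C(|α|/κ+1)³|z|³ ≤ (4C|α|³/κ³ + 4C)|z|³ ≤ (16C|α|³/κ³+4C)|z|³`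
    have hrem : C * (|n₀| + |z|) ^ 3 ≤ (16 * C * |α| ^ 3 / κ ^ 3 + 4 * C) * |z| ^ 3 := by
      have e : |n₀| + |z| = (|α| / κ + 1) * |z| := by rw [hn₀abs]; ring
      rw [e, mul_pow]
      have h3 : (|α| / κ + 1) ^ 3 ≤ 4 * ((|α| / κ) ^ 3 + 1 ^ 3) := Literature.Analysis.FluidPDE.Torus.add_pow_three_le (by positivity) zero_le_one
      have h4 : C * ((|α| / κ + 1) ^ 3 * |z| ^ 3) ≤ C * (4 * ((|α| / κ) ^ 3 + 1) * |z| ^ 3) := by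
        refine mul_le_mul_of_nonneg_left ?_ hC
        exact mul_le_mul_of_nonneg_right (by simpa using h3) (by positivity)
      refine h4.trans ?_
      rw [div_pow]
      have h0 : 0 ≤ C * (|α| ^ 3 / κ ^ 3) * |z| ^ 3 := by positivity
      have e1 : C * (4 * (|α| ^ 3 / κ ^ 3 + 1) * |z| ^ 3) = 4 * (C * (|α| ^ 3 / κ ^ 3) * |z| ^ 3) + 4 * C * |z| ^ 3 := by ring
      have e2 : (16 * C * |α| ^ 3 / κ ^ 3 + 4 * C) * |z| ^ 3 = 16 * (C * (|α| ^ 3 / κ ^ 3) * |z| ^ 3) + 4 * C * |z| ^ 3 := by ring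
      rw [e1, e2]
      linarith
    linarith
  -- ### upper bound at the maximiser `n*`
  have hup : M ≤ N + (α ^ 2 / κ + β) / 2 * z ^ 2 + (16 * C * |α| ^ 3 / κ ^ 3 + 4 * C) * |z| ^ 3 := by
    have hnr : |nstar| ≤ r := abs_le.2 ⟨hnstar.1, hnstar.2⟩
    have h1 := (abs_le.1 (hH nstar z hnr hz)).2
    rw [hsq nstar] at h1
    -- `M = g n* z`
    have hM : M = g nstar z := hmax.symm
    -- the cubic remainder near the ridge
    set d : ℝ := nstar - n₀ with hd
    have hd2r : |d| ≤ 2 * r := by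
      rw [hd]; exact (abs_sub _ _).trans (by linarith)
    have hrem1 : C * (|nstar| + |z|) ^ 3 ≤ 4 * C * |nstar| ^ 3 + 4 * C * |z| ^ 3 := by
      have := Literature.Analysis.FluidPDE.Torus.add_pow_three_le (abs_nonneg nstar) hz0
      nlinarith
    have hrem2 : |nstar| ^ 3 ≤ 4 * |d| ^ 3 + 4 * |n₀| ^ 3 := by
      have e : nstar = d + n₀ := by rw [hd]; ring
      have h := Literature.Analysis.FluidPDE.Torus.add_pow_three_le (abs_nonneg d) (abs_nonneg n₀)
      have h' : |nstar| ≤ |d| + |n₀| := by rw [e]; exact abs_add_le _ _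
      have h'' : |nstar| ^ 3 ≤ (|d| + |n₀|) ^ 3 := pow_le_pow_left₀ (abs_nonneg _) h' 3
      linarith
    -- `16C|d|³ ≤ 32Cr·d² ≤ (κ/2)d²`
    have hrem3 : 16 * C * |d| ^ 3 ≤ κ / 2 * d ^ 2 := by
      rw [abs_pow_three]
      have : 16 * C * |d| ≤ κ / 2 := by nlinarith [mul_le_mul_of_nonneg_left hd2r (by positivity : (0:ℝ) ≤ 16 * C)]
      nlinarith [sq_nonneg d]
    -- `16C|n₀|³ = 16C|α|³|z|³/κ³`
    have hrem4 : 16 * C * |n₀| ^ 3 = 16 * C * |α| ^ 3 / κ ^ 3 * |z| ^ 3 := by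
      rw [hn₀abs, div_pow, mul_pow]; ring
    have key : C * (|nstar| + |z|) ^ 3 ≤ κ / 2 * d ^ 2 + (16 * C * |α| ^ 3 / κ ^ 3 + 4 * C) * |z| ^ 3 := by
      have hC4 : 4 * C * |nstar| ^ 3 ≤ 16 * C * |d| ^ 3 + 16 * C * |n₀| ^ 3 := by nlinarith [hrem2]
      nlinarith [hrem1, hC4, hrem3, hrem4]
    rw [hM]
    have : g nstar z ≤ N + (α ^ 2 / κ + β) / 2 * z ^ 2 - κ / 2 * (nstar - n₀) ^ 2 + C * (|nstar| + |z|) ^ 3 := by linarith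
    rw [← hd] at this
    linarith
  exact abs_le.2 ⟨by linarith, by linarith⟩

/-! ### Quasiconvexity passes to the second-order coefficient -/

/-- Pointwise limits of EVENTUALLY quasiconvex families of real functions on a convex set are quasiconvex. [folklore] -/
theorem quasiconvexOn_of_tendsto_eventually {ι : Type*} {l : Filter ι} [l.NeBot] {S : Set ℝ} (hS : Convex ℝ S) {F : ι → ℝ → ℝ} {f : ℝ → ℝ}
    (hF : ∀ᶠ i in l, QuasiconvexOn ℝ S (F i)) (hlim : ∀ x ∈ S, Tendsto (fun i => F i x) l (𝓝 (f x))) : QuasiconvexOn ℝ S f := by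
  rw [quasiconvexOn_iff_le_max]
  refine ⟨hS, fun x hx y hy a b ha hb hab => ?_⟩
  have hmem : a • x + b • y ∈ S := hS hx hy ha hb hab
  have h1 : Tendsto (fun i => F i (a • x + b • y)) l (𝓝 (f (a • x + b • y))) := hlim _ hmem
  have h2 : Tendsto (fun i => max (F i x) (F i y)) l (𝓝 (max (f x) (f y))) := (hlim x hx).max (hlim y hy)
  exact le_of_tendsto_of_tendsto h1 h2 (hF.mono fun i hi => (quasiconvexOn_iff_le_max.1 hi).2 hx hy ha hb hab)

/-- An increasing affine image `c·f + d` (`c > 0`... indeed `c ≥ 0`) of a quasiconvex real function is quasiconvex. [folklore] -/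
theorem quasiconvexOn_affine_pos {S : Set ℝ} {f : ℝ → ℝ} (hf : QuasiconvexOn ℝ S f) {c : ℝ} (hc : 0 ≤ c) (d : ℝ) :
    QuasiconvexOn ℝ S fun x => c * f x + d := by
  rw [quasiconvexOn_iff_le_max] at hf ⊢
  refine ⟨hf.1, fun x hx y hy a b ha hb hab => ?_⟩
  have h := hf.2 hx hy ha hb hab
  rcases le_total (f x) (f y) with hxy | hxy
  · rw [max_eq_right hxy] at h
    exact le_trans (by nlinarith [mul_le_mul_of_nonneg_left h hc]) (le_max_right _ _)
  · rw [max_eq_left hxy] at h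
    exact le_trans (by nlinarith [mul_le_mul_of_nonneg_left h hc]) (le_max_left _ _)

/-- **(Q2) THE SECOND-ORDER COEFFICIENT OF A QUASICONVEX FAMILY IS QUASICONVEX.**  If `|R(s,z) − N − ½m(s)z²| ≤ C′|z|³` for `s ∈ S`, `0 < |z| ≤ δ′` (`δ′ > 0`), and
`s ↦ R(s,z)` is quasiconvex on the convex set `S` for every such `z`, then `m` is quasiconvex on `S`. -/
theorem quasiconvexOn_coeff_of_expansion {S : Set ℝ} (hS : Convex ℝ S) {R : ℝ → ℝ → ℝ} {m : ℝ → ℝ} {N C' δ' : ℝ} (hδ' : 0 < δ')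
    (hexp : ∀ s ∈ S, ∀ z : ℝ, 0 < |z| → |z| ≤ δ' → |R s z - N - m s / 2 * z ^ 2| ≤ C' * |z| ^ 3)
    (hqc : ∀ z : ℝ, 0 < |z| → |z| ≤ δ' → QuasiconvexOn ℝ S fun s => R s z) :
    QuasiconvexOn ℝ S m := by
  -- the normalised family `F z s := (2/z²)(R s z − N)`, quasiconvex for `0 < |z| ≤ δ'`, tends to `m s` as `z → 0`, `z ≠ 0`
  set F : ℝ → ℝ → ℝ := fun z s => 2 / z ^ 2 * R s z + -(2 / z ^ 2 * N) with hFdef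
  haveI : (𝓝[≠] (0 : ℝ)).NeBot := NormedField.nhdsNE_neBot 0
  refine quasiconvexOn_of_tendsto_eventually (l := 𝓝[≠] (0 : ℝ)) hS (F := F) ?_ ?_
  · -- eventually quasiconvex
    have hev : ∀ᶠ z in 𝓝[≠] (0 : ℝ), 0 < |z| ∧ |z| ≤ δ' := by
      have h1 : ∀ᶠ z in 𝓝[≠] (0 : ℝ), z ≠ 0 := self_mem_nhdsWithin
      have h2 : ∀ᶠ z in 𝓝[≠] (0 : ℝ), |z| ≤ δ' := by
        have : ∀ᶠ z in 𝓝 (0 : ℝ), |z| ≤ δ' := by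
          have := Metric.closedBall_mem_nhds (0 : ℝ) hδ'
          filter_upwards [this] with z hz
          simpa [Real.dist_eq] using hz
        exact nhdsWithin_le_nhds this
      filter_upwards [h1, h2] with z hz1 hz2
      exact ⟨abs_pos.2 hz1, hz2⟩
    filter_upwards [hev] with z hz
    exact quasiconvexOn_affine_pos (hqc z hz.1 hz.2) (by positivity) _
  · -- pointwise convergence: `|F z s − m s| ≤ 2C′|z|`
    intro s hs
    have hC'0 : 0 ≤ C' := by
      have h := hexp s hs δ' (by rwa [abs_of_pos hδ']) (by rw [abs_of_pos hδ'])
      have := (abs_nonneg _).trans h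
      have hδ3 : 0 < |δ'| ^ 3 := by positivity
      nlinarith
    rw [Metric.tendsto_nhdsWithin_nhds]
    intro ε hε
    refine ⟨min δ' (ε / (2 * C' + 1)), lt_min hδ' (by positivity), fun z hz0 hzd => ?_⟩
    have hzne : z ≠ 0 := hz0
    rw [Real.dist_eq, sub_zero] at hzd
    have hzpos : 0 < |z| := abs_pos.2 hzne
    have hzδ : |z| ≤ δ' := (hzd.le.trans (min_le_left _ _))
    have hzε : |z| < ε / (2 * C' + 1) := lt_of_lt_of_le hzd (min_le_right _ _)
    have h := hexp s hs z hzpos hzδ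
    have hz2 : 0 < z ^ 2 := by positivity
    rw [Real.dist_eq]
    have e : F z s - m s = 2 / z ^ 2 * (R s z - N - m s / 2 * z ^ 2) := by
      rw [hFdef]; field_simp; ring
    rw [e, abs_mul, abs_div, abs_of_pos hz2, abs_two]
    have h3 : 2 / z ^ 2 * |R s z - N - m s / 2 * z ^ 2| ≤ 2 / z ^ 2 * (C' * |z| ^ 3) :=
      mul_le_mul_of_nonneg_left h (by positivity)
    have h4 : 2 / z ^ 2 * (C' * |z| ^ 3) = 2 * C' * |z| := by
      rw [abs_pow_three]; field_simp
    have h5 : 2 * C' * |z| < ε := by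
      have := (lt_div_iff₀ (by positivity : (0:ℝ) < 2 * C' + 1)).1 hzε
      nlinarith
    linarith [h3, h4]

/-- **(Q2) in the (TH) column: `|∇ₕ∂_z v₂|²|_H` is quasiconvex along the hot branch.**  If `m(s) = α(s)²/κ + β` with constants `κ > 0`, `β` (the ridge law), and `m` is
quasiconvex on `S`, then so is `s ↦ α(s)²`. -/
theorem quasiconvexOn_sq_of_ridgeLaw {S : Set ℝ} {m α : ℝ → ℝ} {κ β : ℝ} (hκ : 0 < κ) (hm : QuasiconvexOn ℝ S m)
    (hlaw : ∀ s ∈ S, m s = α s ^ 2 / κ + β) : QuasiconvexOn ℝ S fun s => α s ^ 2 := by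
  have h := quasiconvexOn_affine_pos hm hκ.le (-(κ * β))
  have ev : ∀ s ∈ S, κ * m s + -(κ * β) = α s ^ 2 := by
    intro s hs; rw [hlaw s hs]; field_simp; ring
  intro r'
  have hc := h r'
  have e : {x | x ∈ S ∧ (fun s => α s ^ 2) x ≤ r'} = {x | x ∈ S ∧ (fun s => κ * m s + -(κ * β)) x ≤ r'} := by
    ext s
    simp only [mem_setOf_eq]
    constructor
    · rintro ⟨hs, h1⟩; exact ⟨hs, by rw [ev s hs]; exact h1⟩
    · rintro ⟨hs, h1⟩; exact ⟨hs, by rw [← ev s hs]; exact h1⟩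
  rw [e]
  exact hc

end Summit.NavierStokesRegularity.NavierStokesRegularity.Theorems.PoloidalWindowDoorLrcModEntireRidgeSecondOrder
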